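import Literature.NumberTheory.LFunctions.GcdFormProfile
import Literature.NumberTheory.LFunctions.ResonatorTypeDesigns

/-!
# The 2001 design data (AX-A, AX-B, AX-C) from gcd-form type inequalities (W-MAG §§4–5, [CV] §§3–4)

The magnification theorem of the 2001 programme (archive `2001`, `rh-w-magnification/free/y1`, Thm. 1.2:
"for every `M ≥ 0` and every `c ∈ K^{(M)}`, `∑_p (log p − c(p))₊ p^{-1/2} ≤ 2M`, hence RH") is proved in
three layers: (§§2–3) an analytic machine whose output is the **type inequality with defect** for every
finitely supported resonator; (§4 = [CV] §§3–4, and §5 Lemmas 5.1–5.2 / Prop. 5.3) a purely arithmetic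
**design calculus** turning type inequalities into the *design data* AX-A (`∑|c−Λ|(n)/n < ∞`), AX-B (finite
`e₂`-weighted composite mass) and AX-C (the Riesz–Euler design inequality); (§5 Thm. 5.4, §6) the finite
deficit spine and the Landau transfer. This file PROVES the middle layer in the exact interface of the crux
line `Summits/RiemannHypothesis/RiemannHypothesis/Cruxes/ConeMagnification/Lines/Sketch.lean`: its theorem
`designData_of_typeIneq` has as hypotheses (verbatim, with `gcdForm` for the inline double sum) the
conclusions of the stubs `stub_combLocal` (local summability `∑_{p ∣ n} c(n)/n < ∞`) and `stub_combType` (the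
gcd-form type inequality, as a limit of partial sums, with constant `D`; `D = 1/2` there), together with
`c ≥ 0`, `c 1 = 0`, and as conclusion (verbatim) the three design data of `stub_designOfTypes` — so that
stub follows by `exact` (its hypotheses `¬RH`, unit slack, `L`-summability, Carathéodory data and Mertens
are not needed: the type inequalities alone carry the design algebra, as the 2001 sources assert).

## Proof (the 2001 argument)

* `C₁ := lim ∑_{n≤N} (c−Λ)(n)/n` is the type inequality's limit for the trivial resonator `α = δ₁`
  (gcd form `≡ 1`), and `C₁ ≤ D`.
* Local summability gives [CV] Lemma 2.3(ii) (`∑_k |z(p^k)| < ∞`) and Lemma 3.5 (`B_q < ∞`).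
* For a product resonator the gcd form is the product of local profiles
  (`GcdForm.gcdForm_prodResonator`, [CV] Lemma 3.2) and the complex local profile of a real local vector is
  the real local profile of `ResonatorTypeDesigns` (`locProfile_ofReal`); so the limit-form type inequality
  for the (at most two) product resonators of a design, plus the convergence of `∑ z_n` to `C₁` and the
  absolute convergence of `∑ z_n (Φ(n) − Φ(1))`, yields the `tsum`-form field `type_ineq` of
  `TypeDesign.TypeDesignHypotheses D c` — whence AX-A (`TypeDesign.prop41_v`) and AX-B
  (`TypeDesign.summable_compMass`).
* AX-C: the type inequality for the Riesz–Euler resonator (`GcdForm.rieszEulerResonator`; profile computed in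
  `GcdForm.re_gcdForm_rieszEuler`, `gcdForm_rieszEuler_one : Φ(1) = 1`), whose series converges absolutely
  by AX-A, is literally the design inequality `∑' (d(n)/n) Φ_{S,a,φ}(n) ≤ D`.

Sources: archive `2001` — `rh-w-magnification/free/y1` Prop. 4.3, Lemmas 5.1–5.2, Prop. 5.3 (statement level:
stockroom `Rh_WMagnificationY1_MagDeficit.lean`, interface `DesignData`); `rh-w-composite-vanishing/free/y1`
§§3–4; `summits/rh/routes/slack-weil-cone-magnification/paper/paper.tex` Thm. 3.3 (thm:l1). Unpublished
internal preprints; everything here is PROVED (`[folklore]` tags). NOT here: any analytic input.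
-/

noncomputable section

open scoped BigOperators ComplexConjugate Classical
open Filter Finset ArithmeticFunction
open _root_.Topology

namespace Literature.NumberTheory.LFunctions

namespace TypeDesign

open GcdForm

/-! ### The complex local profile of a real local vector is the real local profile -/

/-- The local kernel with swapped indices is the real weight `√p^{2 min(k+i, j) − i − j}` of
`TypeDesign.locProfile`. [folklore] -/
theorem locKernel_swap_eq_zpow {p : ℕ} (hp : p.Prime) (k i j : ℕ) :
    locKernel p k j i =
      (((Real.sqrt (p : ℝ)) ^ ((2 * ((min (k + i) j : ℕ) : ℤ) - (i : ℤ) - (j : ℤ))) : ℝ) : ℂ) := by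
  unfold locKernel
  have hs0 : (0 : ℝ) < Real.sqrt (p : ℝ) := Real.sqrt_pos.2 (by exact_mod_cast hp.pos)
  have hsC : (Real.sqrt (p : ℝ) : ℂ) ≠ 0 := by exact_mod_cast hs0.ne'
  have h1 : ((p : ℝ) : ℂ) ^ min (k + i) j = (Real.sqrt (p : ℝ) : ℂ) ^ (2 * min (k + i) j) := by
    rw [pow_mul, ← Complex.ofReal_pow (Real.sqrt (p : ℝ)) 2, Real.sq_sqrt (Nat.cast_nonneg p)]
  rw [h1, Complex.ofReal_zpow, show (2 * ((min (k + i) j : ℕ) : ℤ) - (i : ℤ) - (j : ℤ)) =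
      ((2 * min (k + i) j : ℕ) : ℤ) - ((j + i : ℕ) : ℤ) by push_cast; ring,
    zpow_sub₀ hsC, zpow_natCast, zpow_natCast]

/-- **Bridge**: for a real local vector `v`, the complex gcd-form local profile at the valuation `v_p(n)` is the
real local profile of `ResonatorTypeDesigns` (swap the summation indices). [folklore] -/
theorem locProfile_ofReal {p : ℕ} (hp : p.Prime) (m : ℕ) (v : ℕ → ℝ) (n : ℕ) :
    GcdForm.locProfile p m (fun i => (v i : ℂ)) (n.factorization p) = (TypeDesign.locProfile p m v n : ℂ) := by
  unfold GcdForm.locProfile TypeDesign.locProfile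
  rw [Finset.sum_comm]
  push_cast
  refine Finset.sum_congr rfl fun i _ => Finset.sum_congr rfl fun j _ => ?_
  rw [locKernel_swap_eq_zpow hp, Complex.conj_ofReal]
  push_cast
  ring

/-- The gcd form of a product resonator with REAL local vectors is real: the product of the real local
profiles, cast to `ℂ` (`n ≠ 0`). [folklore] -/
theorem gcdForm_prodResonator_ofReal {P : Finset ℕ} (hP : ∀ p ∈ P, p.Prime) (m : ℕ) (v : ℕ → ℕ → ℝ)
    {L : ℕ} (hL : smoothModulus P m ≤ L) {n : ℕ} (hn : n ≠ 0) :
    gcdForm (prodResonator P m (fun p i => (v p i : ℂ))) L n = ((∏ p ∈ P, TypeDesign.locProfile p m (v p) n : ℝ) : ℂ) := by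
  rw [gcdForm_prodResonator hP m _ hL hn]
  push_cast
  exact Finset.prod_congr rfl fun p hp => locProfile_ofReal (hP p hp) m (v p) n

/-! ### Limits of partial sums: real-indexed to `ℕ`-indexed, and `Icc 1 N` versus `range` -/

/-- A limit along `x ↦ ∑_{1 ≤ n ≤ ⌊x⌋} f n` gives the limit along `N ↦ ∑_{n < N} f n` when `f 0 = 0`.
[folklore] -/
theorem tendsto_sum_range_of_tendsto_sum_Icc_floor {f : ℕ → ℝ} (hf0 : f 0 = 0) {T : ℝ}
    (h : Tendsto (fun x : ℝ => ∑ n ∈ Finset.Icc 1 ⌊x⌋₊, f n) atTop (𝓝 T)) :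
    Tendsto (fun N : ℕ => ∑ n ∈ Finset.range N, f n) atTop (𝓝 T) := by
  have h1 : Tendsto (fun N : ℕ => ∑ n ∈ Finset.Icc 1 ⌊((N : ℕ) : ℝ)⌋₊, f n) atTop (𝓝 T) :=
    h.comp tendsto_natCast_atTop_atTop
  simp only [Nat.floor_natCast] at h1
  have h2 : (fun N : ℕ => ∑ n ∈ Finset.range (N + 1), f n) = fun N : ℕ => ∑ n ∈ Finset.Icc 1 N, f n := by
    funext N
    rw [Finset.range_eq_Ico, Finset.sum_eq_sum_Ico_succ_bot (Nat.succ_pos N), hf0, zero_add]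
    rfl
  rw [← h2] at h1
  exact (tendsto_add_atTop_iff_nat 1).1 h1

/-! ### The inputs of `TypeDesignHypotheses` from local summability -/

/-- [CV] Lemma 3.5 from local summability: the composite mass on the multiples of `p` is finite. [folklore] -/
theorem summable_comp_of_local {c : ℕ → ℝ} (hc : ∀ n, 0 ≤ c n) {p : ℕ}
    (hloc : Summable (fun n : ℕ => if p ∣ n then c n / n else 0)) :
    Summable fun n : ℕ => if p ∣ n ∧ IsComposite n then c n / (n : ℝ) else 0 := by
  refine Summable.of_nonneg_of_le (fun n => ?_) (fun n => ?_) hloc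
  · split
    · exact div_nonneg (hc n) (Nat.cast_nonneg n)
    · exact le_rfl
  · by_cases h : p ∣ n ∧ IsComposite n
    · rw [if_pos h, if_pos h.1]
    · rw [if_neg h]
      split
      · exact div_nonneg (hc n) (Nat.cast_nonneg n)
      · exact le_rfl

/-- [CV] Lemma 2.3(ii) from local summability: `∑_k |z(p^{k+1})| < ∞`. [folklore] -/
theorem summable_pp_of_local {c : ℕ → ℝ} {p : ℕ} (hp : p.Prime)
    (hloc : Summable (fun n : ℕ => if p ∣ n then c n / n else 0)) :
    Summable fun k : ℕ => |z c (p ^ (k + 1))| := by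
  -- the `c`-part is a subseries of the local series, the `Λ`-part is geometric
  have hinj : Function.Injective fun k : ℕ => p ^ (k + 1) := by
    intro a b hab
    have := Nat.pow_right_injective hp.two_le hab
    omega
  have h1 : Summable fun k : ℕ => c (p ^ (k + 1)) / ((p ^ (k + 1) : ℕ) : ℝ) := by
    have := hloc.comp_injective hinj
    refine this.congr fun k => ?_
    simp only [Function.comp_apply]
    rw [if_pos (dvd_pow_self p (Nat.succ_ne_zero k))]
  have hp1 : (1 : ℝ) < p := by exact_mod_cast hp.one_lt
  have h2 : Summable fun k : ℕ => Real.log p / ((p ^ (k + 1) : ℕ) : ℝ) := by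
    have hgeom : Summable fun k : ℕ => ((p : ℝ)⁻¹) ^ k :=
      summable_geometric_of_lt_one (by positivity) (inv_lt_one_of_one_lt₀ hp1)
    refine ((hgeom.mul_left (Real.log p / p))).congr fun k => ?_
    have hp0 : (p : ℝ) ≠ 0 := by positivity
    rw [inv_pow, Nat.cast_pow, pow_succ]
    field_simp
  refine (h1.abs.add h2.abs).of_nonneg_of_le (fun k => abs_nonneg _) fun k => ?_
  unfold z
  rw [ArithmeticFunction.vonMangoldt_apply_pow (Nat.succ_ne_zero k), ArithmeticFunction.vonMangoldt_apply_prime hp,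
    sub_div]
  exact abs_sub _ _

/-! ### The Riesz–Euler weight is bounded -/

/-- The Riesz–Euler design weight (the `if … then … else 0` expression of AX-C) is bounded by `√(∏_{p∈S} p)`.
[folklore] -/
theorem abs_rieszEulerWeight_le (S : Finset ℕ) (hS : ∀ p ∈ S, p.Prime) (a : ℕ → ℝ)
    (ha : ∀ p ∈ S, 0 ≤ a p ∧ a p ≤ 1) (φ : ℝ) (n : ℕ) :
    |(if ∀ p ∈ S, ¬ (p ^ 2 ∣ n) then
        Real.sqrt (∏ p ∈ S.filter (· ∣ n), (p : ℝ)) * (∏ p ∈ S.filter (· ∣ n), a p) *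
          (1 / 2) ^ (S.filter (· ∣ n)).card * Real.cos (((S.filter (· ∣ n)).card : ℝ) * φ)
      else 0)| ≤ Real.sqrt (∏ p ∈ S, (p : ℝ)) := by
  split_ifs with h
  · have h1 : Real.sqrt (∏ p ∈ S.filter (· ∣ n), (p : ℝ)) ≤ Real.sqrt (∏ p ∈ S, (p : ℝ)) := by
      apply Real.sqrt_le_sqrt
      rw [← Finset.prod_filter_mul_prod_filter_not S (· ∣ n)]
      have hge : (1 : ℝ) ≤ ∏ p ∈ S.filter (fun p => ¬ p ∣ n), (p : ℝ) :=
        Finset.prod_induction _ (fun x : ℝ => 1 ≤ x) (fun a b ha hb => one_le_mul_of_one_le_of_one_le ha hb)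
          le_rfl (fun p hp => by exact_mod_cast (hS p (Finset.mem_filter.1 hp).1).one_lt.le)
      have hnn : (0 : ℝ) ≤ ∏ p ∈ S.filter (· ∣ n), (p : ℝ) := Finset.prod_nonneg fun p _ => Nat.cast_nonneg p
      nlinarith
    have h2 : |∏ p ∈ S.filter (· ∣ n), a p| ≤ 1 := by
      rw [Finset.abs_prod]
      exact Finset.prod_le_one (fun p _ => abs_nonneg _)
        (fun p hp => abs_le.2 ⟨by linarith [(ha p (Finset.mem_filter.1 hp).1).1], (ha p (Finset.mem_filter.1 hp).1).2⟩)
    have h3 : |((1:ℝ) / 2) ^ (S.filter (· ∣ n)).card| ≤ 1 := by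
      rw [abs_pow, abs_of_nonneg (by norm_num : (0:ℝ) ≤ 1 / 2)]
      exact pow_le_one₀ (by norm_num) (by norm_num)
    have h4 : |Real.cos (((S.filter (· ∣ n)).card : ℝ) * φ)| ≤ 1 := Real.abs_cos_le_one _
    have h0 : 0 ≤ Real.sqrt (∏ p ∈ S.filter (· ∣ n), (p : ℝ)) := Real.sqrt_nonneg _
    rw [abs_mul, abs_mul, abs_mul, abs_of_nonneg h0]
    calc Real.sqrt (∏ p ∈ S.filter (· ∣ n), (p : ℝ)) * |∏ p ∈ S.filter (· ∣ n), a p| *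
          |((1:ℝ) / 2) ^ (S.filter (· ∣ n)).card| * |Real.cos (((S.filter (· ∣ n)).card : ℝ) * φ)|
        ≤ Real.sqrt (∏ p ∈ S, (p : ℝ)) * 1 * 1 * 1 := by
          gcongr
    _ = Real.sqrt (∏ p ∈ S, (p : ℝ)) := by ring
  · rw [abs_zero]
    exact Real.sqrt_nonneg _

/-! ### The main theorem -/

/-- The core of `designData_of_typeIneq`, for a weight with the junk value `c 0 = 0`. [folklore] -/
theorem designData_of_typeIneq_core (D : ℝ) (c : ℕ → ℝ) (hc : ∀ n, 0 ≤ c n) (hc0 : c 0 = 0) (hc1 : c 1 = 0)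
    (hloc : ∀ p : ℕ, p.Prime → Summable (fun n : ℕ => if p ∣ n then c n / n else 0))
    (hT : ∀ α : ℕ → ℂ, ∀ L : ℕ, (∀ m, L < m → α m = 0) →
      ∃ T : ℝ, Filter.Tendsto (fun x : ℝ => ∑ n ∈ Finset.Icc 1 ⌊x⌋₊,
          (c n - ArithmeticFunction.vonMangoldt n) / n * (gcdForm α L n).re) Filter.atTop (nhds T) ∧
        T ≤ D * (gcdForm α L 1).re) :
    Summable (fun n : ℕ => |c n - ArithmeticFunction.vonMangoldt n| / (n : ℝ)) ∧
    Summable (fun n : ℕ => if 2 ≤ n ∧ ¬ IsPrimePow n then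
      c n / (n : ℝ) * (∑ q ∈ n.primeFactors, ∑ q' ∈ n.primeFactors.filter (fun q' => q < q'),
        ((Real.sqrt q - 1) / 2) * ((Real.sqrt q' - 1) / 2)) else 0) ∧
    (∀ S : Finset ℕ, (∀ p ∈ S, p.Prime) → ∀ a : ℕ → ℝ, (∀ p ∈ S, 0 ≤ a p ∧ a p ≤ 1) → ∀ φ : ℝ,
      (∑' n : ℕ, (c n - ArithmeticFunction.vonMangoldt n) / (n : ℝ) *
        (if ∀ p ∈ S, ¬ (p ^ 2 ∣ n) then
          Real.sqrt (∏ p ∈ S.filter (· ∣ n), (p : ℝ)) * (∏ p ∈ S.filter (· ∣ n), a p) *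
            (1 / 2) ^ (S.filter (· ∣ n)).card * Real.cos (((S.filter (· ∣ n)).card : ℝ) * φ)
        else 0)) ≤ D) := by
  classical
  -- `z n = (c n - Λ n)/n`, with `z 0 = 0`
  have hz0 : z c 0 = 0 := z_zero
  /- Step 1: `C₁` from the trivial resonator `δ₁` (gcd form `≡ 1`). -/
  set δ₁ : ℕ → ℂ := fun m => if m = 1 then 1 else 0 with hδ₁
  have hδ₁van : ∀ m, 1 < m → δ₁ m = 0 := fun m hm => by simp [hδ₁, hm.ne']
  have hδ₁form : ∀ n : ℕ, gcdForm δ₁ 1 n = 1 := by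
    intro n
    rw [gcdForm_eq_sum_kernel]
    simp [hδ₁, gcdKernel_one_one]
  obtain ⟨C₁, hC₁lim, hC₁le⟩ := hT δ₁ 1 hδ₁van
  simp only [hδ₁form, Complex.one_re, mul_one] at hC₁lim hC₁le
  have htendsto_C₁ : Tendsto (fun N : ℕ => ∑ n ∈ Finset.range N, z c n) atTop (𝓝 C₁) :=
    tendsto_sum_range_of_tendsto_sum_Icc_floor hz0 hC₁lim
  /- Step 2: the `tsum`-form type inequality for two-component product designs. -/
  have htype : ∀ (l₁ l₂ : ℝ) (P₁ P₂ : Finset ℕ) (m₁ m₂ : ℕ) (v₁ v₂ : ℕ → ℕ → ℝ),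
      0 < l₁ → 0 < l₂ → (∀ p ∈ P₁, p.Prime) → (∀ p ∈ P₂, p.Prime) →
      Summable (fun n : ℕ => z c n * (designProfile l₁ l₂ P₁ P₂ m₁ m₂ v₁ v₂ n
        - designProfile l₁ l₂ P₁ P₂ m₁ m₂ v₁ v₂ 1)) →
      designProfile l₁ l₂ P₁ P₂ m₁ m₂ v₁ v₂ 1 * C₁ +
        ∑' n : ℕ, z c n * (designProfile l₁ l₂ P₁ P₂ m₁ m₂ v₁ v₂ n
          - designProfile l₁ l₂ P₁ P₂ m₁ m₂ v₁ v₂ 1) ≤ D * designProfile l₁ l₂ P₁ P₂ m₁ m₂ v₁ v₂ 1 := by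
    intro l₁ l₂ P₁ P₂ m₁ m₂ v₁ v₂ _ _ hP₁ hP₂ hsum
    -- the two product resonators
    set α₁ : ℕ → ℂ := prodResonator P₁ m₁ (fun p i => (v₁ p i : ℂ)) with hα₁
    set α₂ : ℕ → ℂ := prodResonator P₂ m₂ (fun p i => (v₂ p i : ℂ)) with hα₂
    obtain ⟨T₁, hT₁lim, hT₁le⟩ := hT α₁ (smoothModulus P₁ m₁)
      (fun m hm => prodResonator_eq_zero_of_lt _ hm)
    obtain ⟨T₂, hT₂lim, hT₂le⟩ := hT α₂ (smoothModulus P₂ m₂)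
      (fun m hm => prodResonator_eq_zero_of_lt _ hm)
    -- their gcd forms are the real products of local profiles
    have hG₁ : ∀ n : ℕ, n ≠ 0 → (gcdForm α₁ (smoothModulus P₁ m₁) n).re =
        ∏ p ∈ P₁, TypeDesign.locProfile p m₁ (v₁ p) n := fun n hn => by
      rw [hα₁, gcdForm_prodResonator_ofReal hP₁ m₁ v₁ le_rfl hn, Complex.ofReal_re]
    have hG₂ : ∀ n : ℕ, n ≠ 0 → (gcdForm α₂ (smoothModulus P₂ m₂) n).re =
        ∏ p ∈ P₂, TypeDesign.locProfile p m₂ (v₂ p) n := fun n hn => by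
      rw [hα₂, gcdForm_prodResonator_ofReal hP₂ m₂ v₂ le_rfl hn, Complex.ofReal_re]
    -- `ℕ`-indexed limits of the two type sequences
    have hlim₁ : Tendsto (fun N : ℕ => ∑ n ∈ Finset.range N,
        z c n * ∏ p ∈ P₁, TypeDesign.locProfile p m₁ (v₁ p) n) atTop (𝓝 T₁) := by
      refine tendsto_sum_range_of_tendsto_sum_Icc_floor (f := fun n => z c n * ∏ p ∈ P₁,
        TypeDesign.locProfile p m₁ (v₁ p) n) (by simp only [hz0, zero_mul]) ?_
      refine hT₁lim.congr fun x => Finset.sum_congr rfl fun n hn => ?_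
      have hn0 : n ≠ 0 := by have := (Finset.mem_Icc.1 hn).1; omega
      rw [hG₁ n hn0]
      rfl
    have hlim₂ : Tendsto (fun N : ℕ => ∑ n ∈ Finset.range N,
        z c n * ∏ p ∈ P₂, TypeDesign.locProfile p m₂ (v₂ p) n) atTop (𝓝 T₂) := by
      refine tendsto_sum_range_of_tendsto_sum_Icc_floor (f := fun n => z c n * ∏ p ∈ P₂,
        TypeDesign.locProfile p m₂ (v₂ p) n) (by simp only [hz0, zero_mul]) ?_
      refine hT₂lim.congr fun x => Finset.sum_congr rfl fun n hn => ?_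
      have hn0 : n ≠ 0 := by have := (Finset.mem_Icc.1 hn).1; omega
      rw [hG₂ n hn0]
      rfl
    -- the design sequence tends to `l₁ T₁ + l₂ T₂` …
    have hlimΦ : Tendsto (fun N : ℕ => ∑ n ∈ Finset.range N,
        z c n * designProfile l₁ l₂ P₁ P₂ m₁ m₂ v₁ v₂ n) atTop (𝓝 (l₁ * T₁ + l₂ * T₂)) := by
      have := (hlim₁.const_mul l₁).add (hlim₂.const_mul l₂)
      refine this.congr fun N => ?_
      rw [Finset.mul_sum, Finset.mul_sum, ← Finset.sum_add_distrib]
      refine Finset.sum_congr rfl fun n _ => ?_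
      unfold designProfile
      ring
    -- … and also to `Φ(1)·C₁ + ∑' z (Φ − Φ(1))`
    have hlimΦ' : Tendsto (fun N : ℕ => ∑ n ∈ Finset.range N,
        z c n * designProfile l₁ l₂ P₁ P₂ m₁ m₂ v₁ v₂ n) atTop
        (𝓝 (designProfile l₁ l₂ P₁ P₂ m₁ m₂ v₁ v₂ 1 * C₁ +
          ∑' n : ℕ, z c n * (designProfile l₁ l₂ P₁ P₂ m₁ m₂ v₁ v₂ n
            - designProfile l₁ l₂ P₁ P₂ m₁ m₂ v₁ v₂ 1))) := by
      have := (htendsto_C₁.const_mul (designProfile l₁ l₂ P₁ P₂ m₁ m₂ v₁ v₂ 1)).add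
        hsum.hasSum.tendsto_sum_nat
      refine this.congr fun N => ?_
      rw [Finset.mul_sum, ← Finset.sum_add_distrib]
      refine Finset.sum_congr rfl fun n _ => ?_
      ring
    have heq := tendsto_nhds_unique hlimΦ' hlimΦ
    rw [heq]
    -- the values at `n = 1`
    have hΦ1 : designProfile l₁ l₂ P₁ P₂ m₁ m₂ v₁ v₂ 1 =
        l₁ * (gcdForm α₁ (smoothModulus P₁ m₁) 1).re + l₂ * (gcdForm α₂ (smoothModulus P₂ m₂) 1).re := by
      rw [hG₁ 1 one_ne_zero, hG₂ 1 one_ne_zero]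
      rfl
    rw [hΦ1]
    nlinarith [hT₁le, hT₂le]
  /- Step 3: the hypothesis structure, hence AX-A and AX-B. -/
  have H : TypeDesignHypotheses D c :=
    { C₁ := C₁
      nonneg := hc
      c_zero := hc0
      c_one := hc1
      summable_pp := fun p hp => summable_pp_of_local hp (hloc p hp)
      summable_comp := fun p hp => summable_comp_of_local hc (hloc p hp)
      tendsto_C₁ := htendsto_C₁
      type_ineq := htype }
  have hA : Summable (fun n : ℕ => |c n - ArithmeticFunction.vonMangoldt n| / (n : ℝ)) := by
    refine (prop41_v H).congr fun n => ?_
    rw [z, abs_div, Nat.abs_cast]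
  have hB : Summable (fun n : ℕ => if 2 ≤ n ∧ ¬ IsPrimePow n then
      c n / (n : ℝ) * (∑ q ∈ n.primeFactors, ∑ q' ∈ n.primeFactors.filter (fun q' => q < q'),
        ((Real.sqrt q - 1) / 2) * ((Real.sqrt q' - 1) / 2)) else 0) := by
    refine (summable_compMass H).congr fun n => ?_
    unfold compMass eTwo tauP
    split_ifs <;> rfl
  refine ⟨hA, hB, ?_⟩
  /- Step 4: AX-C from the Riesz–Euler resonator. -/
  intro S hS a ha φ
  have ha' : ∀ p ∈ S, -1 ≤ a p ∧ a p ≤ 1 := fun p hp => ⟨by linarith [(ha p hp).1], (ha p hp).2⟩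
  set w : ℕ → ℝ := fun n => if ∀ p ∈ S, ¬ (p ^ 2 ∣ n) then
      Real.sqrt (∏ p ∈ S.filter (· ∣ n), (p : ℝ)) * (∏ p ∈ S.filter (· ∣ n), a p) *
        (1 / 2) ^ (S.filter (· ∣ n)).card * Real.cos (((S.filter (· ∣ n)).card : ℝ) * φ)
    else 0 with hw
  obtain ⟨T, hTlim, hTle⟩ := hT (rieszEulerResonator S a φ) (smoothModulus S 2)
    (fun m hm => rieszEulerResonator_eq_zero_of_lt a φ hm)
  rw [gcdForm_rieszEuler_one hS a φ le_rfl, Complex.one_re, mul_one] at hTle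
  -- the gcd form of the Riesz–Euler resonator IS the weight `w`
  have hre : ∀ n : ℕ, n ≠ 0 → (gcdForm (rieszEulerResonator S a φ) (smoothModulus S 2) n).re = w n :=
    fun n hn => by rw [hw]; exact re_gcdForm_rieszEuler hS ha' φ le_rfl hn
  -- the AX-C series converges absolutely (AX-A and boundedness of `w`)
  have hsumm : Summable (fun n : ℕ => z c n * w n) := by
    refine Summable.of_norm_bounded (g := fun n => Real.sqrt (∏ p ∈ S, (p : ℝ)) * |z c n|)
      ((prop41_v H).mul_left _) fun n => ?_
    rw [Real.norm_eq_abs, abs_mul, mul_comm]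
    exact mul_le_mul_of_nonneg_right (by rw [hw]; exact abs_rieszEulerWeight_le S hS a ha φ n) (abs_nonneg _)
  -- its sum is the limit `T` of the type sequence
  have hlimw : Tendsto (fun N : ℕ => ∑ n ∈ Finset.range N, z c n * w n) atTop (𝓝 T) := by
    refine tendsto_sum_range_of_tendsto_sum_Icc_floor (f := fun n => z c n * w n)
      (by simp only [hz0, zero_mul]) ?_
    refine hTlim.congr fun x => Finset.sum_congr rfl fun n hn => ?_
    have hn0 : n ≠ 0 := by have := (Finset.mem_Icc.1 hn).1; omega
    rw [hre n hn0]
    rfl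
  have heq : ∑' n : ℕ, z c n * w n = T := tendsto_nhds_unique hsumm.hasSum.tendsto_sum_nat hlimw
  have hgoal : ∑' n : ℕ, (c n - ArithmeticFunction.vonMangoldt n) / (n : ℝ) * w n = ∑' n : ℕ, z c n * w n := rfl
  rw [hgoal, heq]
  exact hTle

/-- **The 2001 design data from gcd-form type inequalities** (W-MAG Prop. 4.3 + Lemmas 5.1–5.2 / Prop. 5.3;
[CV] Prop. 4.1; swcm Thm. 3.3): let `c ≥ 0` with `c 1 = 0` satisfy local summability
`∑_{p ∣ n} c(n)/n < ∞` for every prime `p`, and the gcd-form type inequality with constant `D`: for every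
resonator `α : ℕ → ℂ` vanishing above `L`, the partial sums `∑_{n ≤ x} ((c−Λ)(n)/n)·Re Φ_α(n)` converge to a
limit `≤ D · Re Φ_α(1)`. Then (AX-A) `∑ₙ |c(n) − Λ(n)|/n < ∞`; (AX-B) the `e₂`-weighted composite mass
`∑_{n ≥ 2 not a prime power} (c(n)/n) e₂(n)` is finite; (AX-C) for every finite set `S` of primes, amplitudes
`a_p ∈ [0, 1]` and phase `φ`, `∑' ((c−Λ)(n)/n)·Φ_{S,a,φ}(n) ≤ D` with the Riesz–Euler weight
`Φ_{S,a,φ}(n) = 𝟙[S-part of n squarefree]·√(n_A)(∏_{p∈A} a_p) 2^{-|A|} cos(|A|φ)`, `A = {p ∈ S : p ∣ n}`.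
Hypotheses and conclusions are written verbatim as in the crux line `ConeMagnification/Lines/Sketch.lean`
(stubs `stub_combLocal`, `stub_combType`, `stub_designOfTypes`, there with `D = 1/2`); the value `c 0` is
irrelevant (every series has the term `x/0 = 0` at `n = 0`). [folklore] -/
theorem designData_of_typeIneq (D : ℝ) (c : ℕ → ℝ) (hc : ∀ n, 0 ≤ c n) (hc1 : c 1 = 0)
    (hloc : ∀ p : ℕ, p.Prime → Summable (fun n : ℕ => if p ∣ n then c n / n else 0))
    (hT : ∀ α : ℕ → ℂ, ∀ L : ℕ, (∀ m, L < m → α m = 0) →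
      ∃ T : ℝ, Filter.Tendsto (fun x : ℝ => ∑ n ∈ Finset.Icc 1 ⌊x⌋₊,
          (c n - ArithmeticFunction.vonMangoldt n) / n * (gcdForm α L n).re) Filter.atTop (nhds T) ∧
        T ≤ D * (gcdForm α L 1).re) :
    Summable (fun n : ℕ => |c n - ArithmeticFunction.vonMangoldt n| / (n : ℝ)) ∧
    Summable (fun n : ℕ => if 2 ≤ n ∧ ¬ IsPrimePow n then
      c n / (n : ℝ) * (∑ q ∈ n.primeFactors, ∑ q' ∈ n.primeFactors.filter (fun q' => q < q'),
        ((Real.sqrt q - 1) / 2) * ((Real.sqrt q' - 1) / 2)) else 0) ∧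
    (∀ S : Finset ℕ, (∀ p ∈ S, p.Prime) → ∀ a : ℕ → ℝ, (∀ p ∈ S, 0 ≤ a p ∧ a p ≤ 1) → ∀ φ : ℝ,
      (∑' n : ℕ, (c n - ArithmeticFunction.vonMangoldt n) / (n : ℝ) *
        (if ∀ p ∈ S, ¬ (p ^ 2 ∣ n) then
          Real.sqrt (∏ p ∈ S.filter (· ∣ n), (p : ℝ)) * (∏ p ∈ S.filter (· ∣ n), a p) *
            (1 / 2) ^ (S.filter (· ∣ n)).card * Real.cos (((S.filter (· ∣ n)).card : ℝ) * φ)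
        else 0)) ≤ D) := by
  -- replace `c` by the weight `c'` with `c' 0 = 0`; nothing changes
  set c' : ℕ → ℝ := fun n => if n = 0 then 0 else c n with hc'
  have hc'eq : ∀ n, n ≠ 0 → c' n = c n := fun n hn => by simp [hc', hn]
  have hc'0 : c' 0 = 0 := by simp [hc']
  have hc'nn : ∀ n, 0 ≤ c' n := fun n => by
    rcases eq_or_ne n 0 with rfl | hn
    · rw [hc'0]
    · rw [hc'eq n hn]; exact hc n
  have hterm : ∀ (f : ℕ → ℝ) (n : ℕ), (c' n - ArithmeticFunction.vonMangoldt n) / (n : ℝ) * f n =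
      (c n - ArithmeticFunction.vonMangoldt n) / (n : ℝ) * f n := fun f n => by
    rcases eq_or_ne n 0 with rfl | hn
    · simp
    · rw [hc'eq n hn]
  have hloc' : ∀ p : ℕ, p.Prime → Summable (fun n : ℕ => if p ∣ n then c' n / n else 0) := fun p hp => by
    refine (hloc p hp).congr fun n => ?_
    rcases eq_or_ne n 0 with rfl | hn
    · simp
    · rw [hc'eq n hn]
  have hT' : ∀ α : ℕ → ℂ, ∀ L : ℕ, (∀ m, L < m → α m = 0) →
      ∃ T : ℝ, Filter.Tendsto (fun x : ℝ => ∑ n ∈ Finset.Icc 1 ⌊x⌋₊,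
          (c' n - ArithmeticFunction.vonMangoldt n) / n * (gcdForm α L n).re) Filter.atTop (nhds T) ∧
        T ≤ D * (gcdForm α L 1).re := fun α L hα => by
    obtain ⟨T, hTlim, hTle⟩ := hT α L hα
    exact ⟨T, hTlim.congr fun x => Finset.sum_congr rfl fun n _ =>
      (hterm (fun n => (gcdForm α L n).re) n).symm, hTle⟩
  obtain ⟨hA, hB, hC⟩ := designData_of_typeIneq_core D c' hc'nn hc'0 (by rw [hc'eq 1 one_ne_zero, hc1]) hloc' hT'
  refine ⟨hA.congr fun n => ?_, hB.congr fun n => ?_, fun S hS a ha φ => ?_⟩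
  · rcases eq_or_ne n 0 with rfl | hn
    · simp
    · rw [hc'eq n hn]
  · rcases eq_or_ne n 0 with rfl | hn
    · simp
    · rw [hc'eq n hn]
  · have h := hC S hS a ha φ
    set W : ℕ → ℝ := fun n => if ∀ p ∈ S, ¬ (p ^ 2 ∣ n) then
        Real.sqrt (∏ p ∈ S.filter (· ∣ n), (p : ℝ)) * (∏ p ∈ S.filter (· ∣ n), a p) *
          (1 / 2) ^ (S.filter (· ∣ n)).card * Real.cos (((S.filter (· ∣ n)).card : ℝ) * φ)
      else 0 with hW
    have hW' : ∀ n, (c n - ArithmeticFunction.vonMangoldt n) / (n : ℝ) * W n =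
        (c' n - ArithmeticFunction.vonMangoldt n) / (n : ℝ) * W n := fun n => (hterm W n).symm
    calc (∑' n : ℕ, (c n - ArithmeticFunction.vonMangoldt n) / (n : ℝ) * W n)
        = ∑' n : ℕ, (c' n - ArithmeticFunction.vonMangoldt n) / (n : ℝ) * W n := tsum_congr hW'
      _ ≤ D := h

end TypeDesign

end Literature.NumberTheory.LFunctions

end
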